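import Summits.Ventures.QEC.Thresholds.OptimalDecoderThresholds
import Literature.InformationTheory.QuantumCodes.SpherePackingThreshold
import HarnessLib

/-!
# Q5 packaging: the Shannon / hashing CEILING on the code-capacity thresholds of the census CSS families —
# rate `≥ R` forces `h₂(p_c) ≤ 1 - R` in EACH sector, for EVERY decoder family (maximum likelihood included)

Venture QEC, LADDER-QEC rung Q5 (qec-lit-2 gen 5). Theorem-only packaging of
`Literature/InformationTheory/QuantumCodes/SpherePackingThreshold.lean` (the per-sector strong converse, proved there from
Lin–Costello's count of correctable patterns and a Chernoff bound) on the census vocabulary of `CSSFamilyThresholds.lean`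
(`zFailureFamily C D`, `xFailureFamily C D`) and `OptimalDecoderThresholds.lean` (`zOptimalFailureFamily C`,
`xOptimalFailureFamily C`); every bridge is definitional.

For a family of CSS codes `C i` on `n_i → ∞` qubits with `k_i ≥ R · n_i` and a flip rate `0 < p ≤ 1/2` with
`(1 - R) log 2 < h(p)` (natural logarithms, `h = Real.binEntropy`; i.e. `R > 1 - h₂(p)` in bits):

* `z/x_not_belowThreshold_of_rate`: `p` is NOT below threshold for the sector failure family of ANY decoder sequence;
* **`z/x_accuracyThreshold_le_of_rate`**: `accuracyThreshold (zFailureFamily C D) ≤ p` — the certified CEILING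
  `p_c ≤ h₂⁻¹(1 - R)` on `[0, 1/2]` for every decoder family; `z/x_optimal_accuracyThreshold_le_of_rate` for the
  decoder-free optimal families; `z_binEntropy_le_of_isThresholdLowerBound`: every certified floor `a ∈ (0,1/2]` has
  `h(a) ≤ (1 - R) log 2`;
* **`z/x_accuracyThreshold_lt_half_of_rate_pos`**: positive rate ⇒ each sector's threshold is STRICTLY below `1/2`
  for every decoder family (the rate-free ceiling of `CSSThresholdConverses` only bounds the SUM of the two sectors by
  `1/2`).

This is the code-capacity twin of the erasure rate tradeoff `y₀^Z + y₀^X ≤ 1 - R` (`CSSRateTradeoff`), sector by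
sector: `h₂(p₀^Z) ≤ 1 - R` and `h₂(p₀^X) ≤ 1 - R`. Not claimed: any two-sector statement such as `R ≤ 1 - 2h₂(p)`,
anything for `p > 1/2`, any numerical value.

## References

* [RichardsonUrbanke2008] T. Richardson, R. Urbanke, *Modern Coding Theory*, CUP 2008, §1.6 (after Theorem 1.17: the
  strong converse, "1 − h₂(ε) is a threshold value").
* [Mceliece2002] R. McEliece, *The Theory of Information and Coding*, CUP 2002, §6.2 (strong converse).
* [LinCostello2004] S. Lin, D. J. Costello Jr., *Error Control Coding*, 2nd ed., 2004, §3.5 Theorem 3.4.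
* [DennisEtAl2002] E. Dennis, A. Kitaev, A. Landahl, J. Preskill, J. Math. Phys. 43 (2002) 4452, §4.6–4.7.
-/

namespace Summit.Ventures.QEC.Thresholds

open Filter Topology Finset
open Literature.InformationTheory.QuantumCodes

variable {RX RZ Q : ℕ → Type*} [∀ i, Fintype (Q i)] [∀ i, DecidableEq (Q i)] [∀ i, Fintype (RX i)]
  [∀ i, Fintype (RZ i)]

/-! ### `Z`-sector (phase flips, `X`-syndrome), every decoder family -/

/-- **Above the hashing rate no rate is below threshold** (`Z`-sector, every decoder sequence `D`).
[cite: RichardsonUrbanke2008, §1.6 (after Theorem 1.17); DennisEtAl2002, §4.3] -/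
theorem z_not_belowThreshold_of_rate (C : ∀ i, CSSCode (RX i) (RZ i) (Q i))
    (D : ∀ i, Decoder (RX i → ZMod 2) (Q i → ZMod 2)) {p R : ℝ} (hp0 : 0 < p) (hp : p ≤ 1 / 2)
    (hn : Tendsto (fun i => Fintype.card (Q i)) atTop atTop) (hR : ∀ i, R * Fintype.card (Q i) ≤ (C i).k)
    (hcap : (1 - R) * Real.log 2 < Real.binEntropy p) : ¬ BelowThreshold (zFailureFamily C D) p :=
  CSSCode.not_belowThreshold_of_rate C D hp0 hp hn hR hcap

/-- **THE HASHING CEILING `p_c^Z ≤ h₂⁻¹(1 - R)`** (every decoder family): for a census CSS family with `n_i → ∞` and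
`k_i ≥ R n_i`, every `0 < p ≤ 1/2` with `(1 - R) log 2 < h(p)` satisfies `accuracyThreshold (zFailureFamily C D) ≤ p`.
[cite: RichardsonUrbanke2008, §1.6 (C_BSC(ε) = 1 − h₂(ε) separates what is achievable from what is not);
DennisEtAl2002, §4.6 (R = 1 − 2H₂(p), p_c)] -/
theorem z_accuracyThreshold_le_of_rate (C : ∀ i, CSSCode (RX i) (RZ i) (Q i))
    (D : ∀ i, Decoder (RX i → ZMod 2) (Q i → ZMod 2)) {p R : ℝ} (hp0 : 0 < p) (hp : p ≤ 1 / 2)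
    (hn : Tendsto (fun i => Fintype.card (Q i)) atTop atTop) (hR : ∀ i, R * Fintype.card (Q i) ≤ (C i).k)
    (hcap : (1 - R) * Real.log 2 < Real.binEntropy p) : accuracyThreshold (zFailureFamily C D) ≤ p :=
  CSSCode.accuracyThreshold_le_of_rate C D hp0 hp hn hR hcap

/-- **Certified floors respect the hashing ceiling** (`Z`-sector): a threshold lower bound `a ∈ (0, 1/2]` of any
decoder family of a rate-`R` census family has `h(a) ≤ (1 - R) log 2`.
[cite: RichardsonUrbanke2008, §1.6; DennisEtAl2002, §4.6] -/
theorem z_binEntropy_le_of_isThresholdLowerBound (C : ∀ i, CSSCode (RX i) (RZ i) (Q i))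
    (D : ∀ i, Decoder (RX i → ZMod 2) (Q i → ZMod 2)) {a R : ℝ} (ha0 : 0 < a) (ha : a ≤ 1 / 2)
    (hn : Tendsto (fun i => Fintype.card (Q i)) atTop atTop) (hR : ∀ i, R * Fintype.card (Q i) ≤ (C i).k)
    (hlb : IsThresholdLowerBound (zFailureFamily C D) a) : Real.binEntropy a ≤ (1 - R) * Real.log 2 :=
  CSSCode.binEntropy_le_of_isThresholdLowerBound C D ha0 ha hn hR hlb

/-- **Positive rate ⇒ `p_c^Z < 1/2` for every decoder family.** [cite: RichardsonUrbanke2008, §1.6; DennisEtAl2002, §4.6] -/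
theorem z_accuracyThreshold_lt_half_of_rate_pos (C : ∀ i, CSSCode (RX i) (RZ i) (Q i))
    (D : ∀ i, Decoder (RX i → ZMod 2) (Q i → ZMod 2)) {R : ℝ} (hR0 : 0 < R)
    (hn : Tendsto (fun i => Fintype.card (Q i)) atTop atTop) (hR : ∀ i, R * Fintype.card (Q i) ≤ (C i).k) :
    accuracyThreshold (zFailureFamily C D) < 1 / 2 :=
  CSSCode.accuracyThreshold_lt_half_of_rate_pos C D hR0 hn hR

/-! ### `X`-sector (bit flips, `Z`-syndrome), every decoder family -/

/-- **`X`-sector: above the hashing rate no rate is below threshold.** [cite: RichardsonUrbanke2008, §1.6; DennisEtAl2002, §4.3] -/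
theorem x_not_belowThreshold_of_rate (C : ∀ i, CSSCode (RX i) (RZ i) (Q i))
    (D : ∀ i, Decoder (RZ i → ZMod 2) (Q i → ZMod 2)) {p R : ℝ} (hp0 : 0 < p) (hp : p ≤ 1 / 2)
    (hn : Tendsto (fun i => Fintype.card (Q i)) atTop atTop) (hR : ∀ i, R * Fintype.card (Q i) ≤ (C i).k)
    (hcap : (1 - R) * Real.log 2 < Real.binEntropy p) : ¬ BelowThreshold (xFailureFamily C D) p :=
  CSSCode.not_belowThreshold_of_rate_x C D hp0 hp hn hR hcap

/-- **THE HASHING CEILING `p_c^X ≤ h₂⁻¹(1 - R)`** (every decoder family).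
[cite: RichardsonUrbanke2008, §1.6; DennisEtAl2002, §4.6] -/
theorem x_accuracyThreshold_le_of_rate (C : ∀ i, CSSCode (RX i) (RZ i) (Q i))
    (D : ∀ i, Decoder (RZ i → ZMod 2) (Q i → ZMod 2)) {p R : ℝ} (hp0 : 0 < p) (hp : p ≤ 1 / 2)
    (hn : Tendsto (fun i => Fintype.card (Q i)) atTop atTop) (hR : ∀ i, R * Fintype.card (Q i) ≤ (C i).k)
    (hcap : (1 - R) * Real.log 2 < Real.binEntropy p) : accuracyThreshold (xFailureFamily C D) ≤ p :=
  CSSCode.accuracyThreshold_le_of_rate_x C D hp0 hp hn hR hcap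

/-- **Positive rate ⇒ `p_c^X < 1/2` for every decoder family.** [cite: RichardsonUrbanke2008, §1.6; DennisEtAl2002, §4.6] -/
theorem x_accuracyThreshold_lt_half_of_rate_pos (C : ∀ i, CSSCode (RX i) (RZ i) (Q i))
    (D : ∀ i, Decoder (RZ i → ZMod 2) (Q i → ZMod 2)) {R : ℝ} (hR0 : 0 < R)
    (hn : Tendsto (fun i => Fintype.card (Q i)) atTop atTop) (hR : ∀ i, R * Fintype.card (Q i) ≤ (C i).k) :
    accuracyThreshold (xFailureFamily C D) < 1 / 2 :=
  CSSCode.accuracyThreshold_lt_half_of_rate_pos_x C D hR0 hn hR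

/-! ### The decoder-free OPTIMAL families -/

/-- **The optimal `Z`-threshold obeys the hashing ceiling**: `accuracyThreshold (zOptimalFailureFamily C) ≤ p` for
every `0 < p ≤ 1/2` with `(1 - R) log 2 < h(p)`, and such `p` is not below threshold for the optimal family.
[cite: RichardsonUrbanke2008, §1.6 (MAP decoding; converse); DennisEtAl2002, §4.6 (p_c) and §4.7] -/
theorem z_optimal_accuracyThreshold_le_of_rate (C : ∀ i, CSSCode (RX i) (RZ i) (Q i)) {p R : ℝ}
    (hp0 : 0 < p) (hp : p ≤ 1 / 2) (hn : Tendsto (fun i => Fintype.card (Q i)) atTop atTop)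
    (hR : ∀ i, R * Fintype.card (Q i) ≤ (C i).k) (hcap : (1 - R) * Real.log 2 < Real.binEntropy p) :
    ¬ BelowThreshold (zOptimalFailureFamily C) p ∧ accuracyThreshold (zOptimalFailureFamily C) ≤ p :=
  CSSCode.optimal_accuracyThreshold_le_of_rate C hp0 hp hn hR hcap

/-- **The optimal `X`-threshold obeys the hashing ceiling** (via the `X ↔ Z` exchange).
[cite: RichardsonUrbanke2008, §1.6; DennisEtAl2002, §4.6 and §4.7] -/
theorem x_optimal_accuracyThreshold_le_of_rate (C : ∀ i, CSSCode (RX i) (RZ i) (Q i)) {p R : ℝ}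
    (hp0 : 0 < p) (hp : p ≤ 1 / 2) (hn : Tendsto (fun i => Fintype.card (Q i)) atTop atTop)
    (hR : ∀ i, R * Fintype.card (Q i) ≤ (C i).k) (hcap : (1 - R) * Real.log 2 < Real.binEntropy p) :
    ¬ BelowThreshold (xOptimalFailureFamily C) p ∧ accuracyThreshold (xOptimalFailureFamily C) ≤ p := by
  rw [xOptimalFailureFamily_eq_swap]
  exact CSSCode.optimal_accuracyThreshold_le_of_rate (fun i => (C i).swap) hp0 hp hn
    (fun i => by rw [CSSCode.k_swap]; exact hR i) hcap

/-- **Positive rate ⇒ the OPTIMAL `Z`-threshold is `< 1/2`.** [cite: RichardsonUrbanke2008, §1.6; DennisEtAl2002, §4.6 and §4.7] -/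
theorem z_optimal_accuracyThreshold_lt_half_of_rate_pos (C : ∀ i, CSSCode (RX i) (RZ i) (Q i)) {R : ℝ}
    (hR0 : 0 < R) (hn : Tendsto (fun i => Fintype.card (Q i)) atTop atTop)
    (hR : ∀ i, R * Fintype.card (Q i) ≤ (C i).k) : accuracyThreshold (zOptimalFailureFamily C) < 1 / 2 :=
  CSSCode.optimal_accuracyThreshold_lt_half_of_rate_pos C hR0 hn hR

end Summit.Ventures.QEC.Thresholds
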